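import Summits.QuantumFields.YangMills.Theorems.FlatTubeReductionOrthoDensityFlatMap
import Summits.QuantumFields.YangMills.Theorems.LuscherReductionTwistedTraceScalingGaugeGroupGnChart
import Summits.QuantumFields.YangMills.Theorems.LuscherReductionTwistedTraceScalingCovariantCurl
import Summits.QuantumFields.YangMills.Theorems.LuscherReductionDressedRitzPolyakovLiftTransplantDilation
import HarnessLib

/-!
# The flat density of the transverse measure, III: the flat box and its volume, the slow window, the tube set over `A` as a gnomonic image, the product formula
# `σ³(window)·π(A) = σ^{⊗E}(tube set)`, and the product gnomonic chart law on images of flat sets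
# («(E′)-lite» infrastructure; route `FlatTubeReduction`, crux K1 `NearFlatRatioLaw` stmt-QuantumFields-24720; seat `ym-line-ftr-p1` g16; R2b1 RECORD rung — no summit statement is proved here)

WHY (memo `Cruxes/NearFlatRatioLaw/Lines/ratepack-v5-nearpair-g16.md` §5).  The measure-theoretic half of (E′)-lite.  With the flat box
`S(r, A) = {y : base coordinates in the sup-ball of radius r, balFill L y ∈ A}`:
* §1 `flatBox_def` (a preimage under `MeasurableEquiv.piEquivPiSubtypeProd`), `measurableSet_flatBox`, ★ `volume_flatBox` (`vol S = vol(ball_r)·balLebesgue L A`, Fubini for the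
  base/off-base splitting), `flatBox_subset_ball`;
* §2 the slow window `{u : every link in the open upper hemisphere with gnomonic coordinate of norm < r}` (open, contains `1`, positive one-site measure), ★★ `slowEmb_image_eq`
  (the tube set `{orthoTube L u⁻¹ v : u ∈ window, v ∈ A}` IS the gnomonic image of `orthoFlat L '' S(r,A)` for `r ≤ 1/(4N)`, `A ⊆ capBalancedSet ∩ ball 0 (1/(4N))`),
  `measurableSet_slowEmb_image` (slow EMBEDDING), ★★ `configMeasure_slowWindow_mul_orthoTransverse` (`σ³(window)·π(A) = σ^{⊗E}(tube set)`, lane A's `SlowChart.slowMeasure_prod`);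
* §3 ★★ `configMeasure_image_gnoPoint` (`σ^{⊗E}` of a gnomonic image `=` the product gnomonic law of the flat set, lane A's `GnChart.pi_haar_su2_eq_sum_piPatternChart`: only the
  all-upper pattern meets the image), `piGnDensity_bounds`, ★ `withDensity_piGnDensity_two_sided` (two-sidedly Lebesgue on the sup-box `{|z_e a| ≤ 2}`, any set).
HONEST FRAMING: measure bookkeeping; femto rung R2b1 (RECORD label); not infinite volume, not a gap, not Clay.  No defs, no named facts, no `sorry`.
-/

set_option autoImplicit false

noncomputable section

open MeasureTheory Filter Topology Real
open scoped BigOperators Matrix NNReal ENNReal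
open Literature.MathematicalPhysics.QuantumFieldTheory
open Literature.MathematicalPhysics.QuantumLattice
open Literature.MathematicalPhysics.QuantumFieldTheory.Balaban1983to89.T4CubeChartGnomonic (gnoPoint gnoPoint_injective gnoWeight gnoWeight_le gnoWeight_ge_of_mem_cube)

namespace Summit.QuantumFields.YangMills.Theorems.FemtoTransferGap.TwoLattice.ConstTube

open Summit.QuantumFields.YangMills.Theorems.FemtoTransferGap
open Summit.QuantumFields.YangMills.Theorems.FemtoTransferGap.TwoLattice.SlowChart
open Summit.QuantumFields.YangMills.Theorems.FemtoTransferGap.TwoLattice.GnChart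
open Literature.MathematicalPhysics.QuantumFieldTheory.Balaban1983to89.T4CubePoincare (cube mem_cube_iff)
open Summit.QuantumFields.YangMills.Theorems.FemtoTransferGap.TwoLattice.Cov (scalarPart_inv vecPart_inv)

variable (L : ℕ) [NeZero L]

/-! ## §1 The flat box and its volume: `vol(flatBox r A) = vol(ball_r) · balLebesgue A` -/

/-- **The flat box over `A`**: coordinate vectors whose base coordinates lie in the sup-ball of radius `r` and whose balancing fill lies in `A`. [folklore] -/
theorem flatBox_def (r : ℝ) (A : Set (Edge 3 L → Fin 3 → ℝ)) :
    {y : Edge 3 L → Fin 3 → ℝ | (fun i : {e : Edge 3 L // e.1 = 0} => y i.1) ∈ Metric.ball (0 : {e : Edge 3 L // e.1 = 0} → Fin 3 → ℝ) r ∧ balFill L y ∈ A} =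
      (MeasurableEquiv.piEquivPiSubtypeProd (fun _ : Edge 3 L => Fin 3 → ℝ) (fun e => e.1 = 0)) ⁻¹'
        (Metric.ball (0 : {e : Edge 3 L // e.1 = 0} → Fin 3 → ℝ) r ×ˢ ((balExt L) ⁻¹' A)) := by
  ext y
  simp only [Set.mem_setOf_eq, Set.mem_preimage, Set.mem_prod, MeasurableEquiv.piEquivPiSubtypeProd_apply, balFill_eq_balExt]

/-- `balFill` is continuous (linear). [folklore] -/
theorem continuous_balFill : Continuous (balFill L) :=
  (balExt L).continuous.comp (continuous_pi fun e' => continuous_apply e'.1)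

/-- The flat box over a measurable `A` is measurable. [folklore] -/
theorem measurableSet_flatBox (r : ℝ) {A : Set (Edge 3 L → Fin 3 → ℝ)} (hA : MeasurableSet A) :
    MeasurableSet {y : Edge 3 L → Fin 3 → ℝ | (fun i : {e : Edge 3 L // e.1 = 0} => y i.1) ∈ Metric.ball (0 : {e : Edge 3 L // e.1 = 0} → Fin 3 → ℝ) r ∧ balFill L y ∈ A} := by
  rw [flatBox_def]
  exact (MeasurableEquiv.measurable _) (Metric.isOpen_ball.measurableSet.prod ((balExt L).continuous.measurable hA))

/-- ★ **The volume of the flat box**: `vol(flatBox r A) = vol(ball 0 r) · balLebesgue L A`. [folklore] -/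
theorem volume_flatBox (r : ℝ) {A : Set (Edge 3 L → Fin 3 → ℝ)} (hA : MeasurableSet A) :
    volume {y : Edge 3 L → Fin 3 → ℝ | (fun i : {e : Edge 3 L // e.1 = 0} => y i.1) ∈ Metric.ball (0 : {e : Edge 3 L // e.1 = 0} → Fin 3 → ℝ) r ∧ balFill L y ∈ A} =
      volume (Metric.ball (0 : {e : Edge 3 L // e.1 = 0} → Fin 3 → ℝ) r) * balLebesgue L A := by
  rw [flatBox_def]
  have hmp := volume_preserving_piEquivPiSubtypeProd (fun _ : Edge 3 L => Fin 3 → ℝ) (fun e => e.1 = 0)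
  rw [hmp.measure_preimage (Metric.isOpen_ball.measurableSet.prod ((balExt L).continuous.measurable hA)).nullMeasurableSet, Measure.volume_eq_prod,
    Measure.prod_prod, balLebesgue, Measure.map_apply (balExt L).continuous.measurable hA]

/-- The flat box lies in the sup-ball of radius `ρ` as soon as `r ≤ ρ` and `A ⊆ ball 0 ρ`. [folklore] -/
theorem flatBox_subset_ball {r ρ : ℝ} (hρ : 0 < ρ) (hr : r ≤ ρ) {A : Set (Edge 3 L → Fin 3 → ℝ)} (hA : A ⊆ Metric.ball 0 ρ) :
    {y : Edge 3 L → Fin 3 → ℝ | (fun i : {e : Edge 3 L // e.1 = 0} => y i.1) ∈ Metric.ball (0 : {e : Edge 3 L // e.1 = 0} → Fin 3 → ℝ) r ∧ balFill L y ∈ A} ⊆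
      Metric.ball 0 ρ := by
  rintro y ⟨hb, hv⟩
  rw [mem_ball_zero_iff, pi_norm_lt_iff hρ]
  intro e
  by_cases he : e.1 = 0
  · have hb' := mem_ball_zero_iff.1 hb
    have hrpos : 0 < r := (norm_nonneg _).trans_lt hb'
    have h := (pi_norm_lt_iff hrpos).1 hb' ⟨e, he⟩
    exact h.trans_le hr
  · have h1 : y e = balFill L y e := funext fun a => (balFill_apply_of_ne L y he a).symm
    rw [h1]
    exact (norm_le_pi_norm _ e).trans_lt (mem_ball_zero_iff.1 (hA hv))

/-! ## §2 The slow window and the tube set over `A` -/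

/-- **The slow window** of gnomonic radius `r`: every one-site link in the open upper hemisphere with gnomonic coordinate of sup-norm `< r`; an OPEN set containing `1`.
[folklore] -/
theorem isOpen_slowWindow (r : ℝ) : IsOpen {u : GaugeConfig 3 1 SU2 | ∀ e₁ : Edge 3 1, 0 < scalarPart (u e₁) ∧ ‖vecPart (u e₁)‖ < r * scalarPart (u e₁)} := by
  have h : {u : GaugeConfig 3 1 SU2 | ∀ e₁ : Edge 3 1, 0 < scalarPart (u e₁) ∧ ‖vecPart (u e₁)‖ < r * scalarPart (u e₁)} =
      ⋂ e₁ : Edge 3 1, {u | 0 < scalarPart (u e₁)} ∩ {u | ‖vecPart (u e₁)‖ < r * scalarPart (u e₁)} := by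
    ext u; simp
  rw [h]
  refine isOpen_iInter_of_finite fun e₁ => IsOpen.inter ?_ ?_
  · exact isOpen_lt continuous_const (continuous_scalarPart.comp (continuous_apply e₁))
  · exact isOpen_lt ((continuous_vecPart.comp (continuous_apply e₁)).norm) (continuous_const.mul (continuous_scalarPart.comp (continuous_apply e₁)))

/-- `1` lies in the slow window (for `r > 0`). [folklore] -/
theorem one_mem_slowWindow {r : ℝ} (hr : 0 < r) : (1 : GaugeConfig 3 1 SU2) ∈ {u : GaugeConfig 3 1 SU2 | ∀ e₁ : Edge 3 1, 0 < scalarPart (u e₁) ∧ ‖vecPart (u e₁)‖ < r * scalarPart (u e₁)} := by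
  intro e₁
  rw [Pi.one_apply, PolyakovLift.scalarPart_one, PolyakovLift.vecPart_one, norm_zero, mul_one]
  exact ⟨one_pos, hr⟩

/-- The slow window has positive, finite one-site measure. [folklore] -/
theorem configMeasure_slowWindow_pos {r : ℝ} (hr : 0 < r) :
    0 < configMeasure SU2 1 {u : GaugeConfig 3 1 SU2 | ∀ e₁ : Edge 3 1, 0 < scalarPart (u e₁) ∧ ‖vecPart (u e₁)‖ < r * scalarPart (u e₁)} := by
  haveI := configMeasure_isOpenPosMeasure (G := SU2) 1
  exact (isOpen_slowWindow r).measure_pos _ ⟨1, one_mem_slowWindow hr⟩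

/-- ★★ **THE TUBE OVER `A` THROUGH THE SLOW WINDOW IS THE GNOMONIC IMAGE OF THE FLAT IMAGE OF THE FLAT BOX**: for `r ≤ 1/(4N)` and `A ⊆ capBalancedSet L ∩ ball 0 (1/(4N))`,
`{orthoTube L u⁻¹ v : u ∈ window_r, v ∈ A} = (e ↦ gnoPoint (z e)) '' (orthoFlat L '' flatBox r A)`. [folklore] -/
theorem slowEmb_image_eq {r : ℝ} (hr0 : 0 < r) (hr : r ≤ 1 / (4 * Fintype.card (Site 3 L))) {A : Set (Edge 3 L → Fin 3 → ℝ)} (hAc : A ⊆ capBalancedSet L)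
    (hAb : A ⊆ Metric.ball 0 (1 / (4 * Fintype.card (Site 3 L)))) :
    slowEmb (orthoChart L) '' ({u : GaugeConfig 3 1 SU2 | ∀ e₁ : Edge 3 1, 0 < scalarPart (u e₁) ∧ ‖vecPart (u e₁)‖ < r * scalarPart (u e₁)} ×ˢ
        ((Subtype.val : capBalancedSet L → Edge 3 L → Fin 3 → ℝ) ⁻¹' A)) =
      (fun z : Edge 3 L → Fin 3 → ℝ => fun e => gnoPoint (z e)) ''
        (orthoFlat L '' {y : Edge 3 L → Fin 3 → ℝ | (fun i : {e : Edge 3 L // e.1 = 0} => y i.1) ∈ Metric.ball (0 : {e : Edge 3 L // e.1 = 0} → Fin 3 → ℝ) r ∧ balFill L y ∈ A}) := by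
  have hN : (0 : ℝ) < Fintype.card (Site 3 L) := by exact_mod_cast Fintype.card_pos
  have hρ : 0 < 1 / (4 * (Fintype.card (Site 3 L) : ℝ)) := by positivity
  ext U
  simp only [Set.mem_image, Set.mem_prod, Set.mem_setOf_eq, Set.mem_preimage, Prod.exists, Subtype.exists]
  constructor
  · rintro ⟨u, v, hv, ⟨hu, hvA⟩, rfl⟩
    -- the flat datum: base coordinates = gnomonic coordinates of `u⁻¹`, off-base coordinates = `v`
    set y : Edge 3 L → Fin 3 → ℝ := fun e => if e.1 = 0 then gnLink (u (0, e.2))⁻¹ else v e with hy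
    have hyoff : ∀ e : Edge 3 L, ¬e.1 = 0 → y e = v e := fun e he => by simp [hy, he]
    have hybase : ∀ k : Fin 3, y (0, k) = gnLink (u (0, k))⁻¹ := fun k => by simp [hy]
    have hfill : balFill L y = v := balFill_eq_of_agree L hv.1 hyoff
    have hbase : baseGno L y = u⁻¹ := by
      funext e₁
      have he₁ : e₁ = ((0 : Site 3 1), e₁.2) := Prod.ext (Subsingleton.elim _ _) rfl
      rw [baseGno, hybase, Pi.inv_apply, gnoPoint_gnLink _ (by rw [scalarPart_inv]; exact (hu _).1), ← he₁]
    -- the base coordinates are small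
    have hbn : ∀ k : Fin 3, ‖y (0, k)‖ < r := fun k => by
      rw [hybase]
      obtain ⟨hs, hvr⟩ := hu ((0 : Site 3 1), k)
      have hgl : gnLink (u (0, k))⁻¹ = (scalarPart (u (0, k)))⁻¹ • (-vecPart (u (0, k))) := by
        funext a; rw [gnLink_apply, vecPart_inv, scalarPart_inv, Pi.smul_apply, smul_eq_mul, div_eq_inv_mul]
      rw [hgl, norm_smul, norm_neg, norm_inv, Real.norm_eq_abs, abs_of_pos hs, inv_mul_lt_iff₀ hs]
      linarith [mul_comm r (scalarPart (u (0, k)))]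
    have hyn : ‖y‖ ≤ 1 / (4 * Fintype.card (Site 3 L)) := by
      refine (pi_norm_le_iff_of_nonneg hρ.le).2 fun e => ?_
      by_cases he : e.1 = 0
      · obtain ⟨x, k⟩ := e
        simp only at he; subst he
        exact ((hbn k).le.trans hr)
      · rw [hyoff e he]; exact (norm_le_pi_norm v e).trans (mem_ball_zero_iff.1 (hAb hvA)).le
    refine ⟨orthoFlat L y, ⟨y, ⟨?_, by rw [hfill]; exact hvA⟩, rfl⟩, ?_⟩
    · rw [mem_ball_zero_iff, pi_norm_lt_iff hr0]
      rintro ⟨⟨x, k⟩, hx⟩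
      simp only at hx; subst hx
      exact hbn k
    · funext e
      rw [(gnoPoint_orthoFlat L hyn e).2, hbase, hfill]
      rfl
  · rintro ⟨z, ⟨y, ⟨hyb, hyA⟩, rfl⟩, rfl⟩
    have hyn : ‖y‖ ≤ 1 / (4 * Fintype.card (Site 3 L)) := by
      refine le_of_lt (mem_ball_zero_iff.1 (flatBox_subset_ball L hρ hr hAb ⟨hyb, hyA⟩))
    refine ⟨(baseGno L y)⁻¹, balFill L y, hAc hyA, ⟨fun e₁ => ?_, hyA⟩, ?_⟩
    · rw [Pi.inv_apply, scalarPart_inv, vecPart_inv, norm_neg, baseGno]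
      refine ⟨scalarPart_gnoPoint_pos _, ?_⟩
      have hvp : vecPart (gnoPoint (y (0, e₁.2))) = scalarPart (gnoPoint (y (0, e₁.2))) • y (0, e₁.2) := vecPart_gnoPoint_eq_smul _
      rw [hvp, norm_smul, Real.norm_eq_abs, abs_of_pos (scalarPart_gnoPoint_pos _), mul_comm]
      refine mul_lt_mul_of_pos_right ?_ (scalarPart_gnoPoint_pos _)
      have hb := (pi_norm_lt_iff hr0).1 (mem_ball_zero_iff.1 hyb) ⟨((0 : Site 3 L), e₁.2), rfl⟩
      exact hb
    · funext e
      show orthoTube L (baseGno L y)⁻¹⁻¹ (balFill L y) e = gnoPoint (orthoFlat L y e)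
      rw [inv_inv, (gnoPoint_orthoFlat L hyn e).2]

/-- The tube set through the slow window over a measurable `A` is measurable (image of a measurable rectangle under the slow EMBEDDING). [folklore] -/
theorem measurableSet_slowEmb_image (r : ℝ) {A : Set (Edge 3 L → Fin 3 → ℝ)} (hA : MeasurableSet A) :
    MeasurableSet (slowEmb (orthoChart L) '' ({u : GaugeConfig 3 1 SU2 | ∀ e₁ : Edge 3 1, 0 < scalarPart (u e₁) ∧ ‖vecPart (u e₁)‖ < r * scalarPart (u e₁)} ×ˢ
        ((Subtype.val : capBalancedSet L → Edge 3 L → Fin 3 → ℝ) ⁻¹' A))) := by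
  haveI : PolishSpace (capBalancedSet L) := (isClosed_capBalancedSet L).polishSpace
  exact (measurableEmbedding_slowEmb (continuous_orthoChart L) (orthoChart_injective L)).measurableSet_image.2
    ((isOpen_slowWindow r).measurableSet.prod (measurable_subtype_coe hA))

/-- ★★ **THE PRODUCT FORMULA FOR THE TRANSVERSE MEASURE**: `σ³(window_r) · π(A) = σ^{⊗E}(tube set over A)`. [folklore] -/
theorem configMeasure_slowWindow_mul_orthoTransverse (r : ℝ) {A : Set (Edge 3 L → Fin 3 → ℝ)} (hA : MeasurableSet A) :
    configMeasure SU2 1 {u : GaugeConfig 3 1 SU2 | ∀ e₁ : Edge 3 1, 0 < scalarPart (u e₁) ∧ ‖vecPart (u e₁)‖ < r * scalarPart (u e₁)} * orthoTransverse L A =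
      configMeasure SU2 L (slowEmb (orthoChart L) '' ({u : GaugeConfig 3 1 SU2 | ∀ e₁ : Edge 3 1, 0 < scalarPart (u e₁) ∧ ‖vecPart (u e₁)‖ < r * scalarPart (u e₁)} ×ˢ
        ((Subtype.val : capBalancedSet L → Edge 3 L → Fin 3 → ℝ) ⁻¹' A))) := by
  haveI : PolishSpace (capBalancedSet L) := (isClosed_capBalancedSet L).polishSpace
  rw [← slowMeasure_apply (continuous_orthoChart L) (orthoChart_injective L),
    slowMeasure_prod (continuous_orthoChart L) (orthoChart_injective L) (orthoChart_mul L) (isOpen_slowWindow r).measurableSet (measurable_subtype_coe hA),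
    orthoTransverse, Measure.map_apply measurable_subtype_coe hA]

/-! ## §3 The product gnomonic chart law on images of flat sets -/

/-- ★★ **HAAR MEASURE OF A GNOMONIC IMAGE**: for any `W ⊆ (Edge → ℝ³)` whose gnomonic image `{(P(1,z_e))_e : z ∈ W}` is measurable,
`σ^{⊗E}(image) = ∫⁻_W Π_e (2π²)⁻¹(1+|z_e|²)⁻² dz` (lane A's `GnChart.pi_haar_su2_eq_sum_piPatternChart`: only the all-upper pattern meets the image, and the chart is injective).
[folklore] -/
theorem configMeasure_image_gnoPoint {W : Set (Edge 3 L → Fin 3 → ℝ)} (hT : MeasurableSet ((fun z : Edge 3 L → Fin 3 → ℝ => fun e => gnoPoint (z e)) '' W)) :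
    configMeasure SU2 L ((fun z : Edge 3 L → Fin 3 → ℝ => fun e => gnoPoint (z e)) '' W) =
      ((volume : Measure (Edge 3 L → Fin 3 → ℝ)).withDensity (piGnDensity (Edge 3 L))) W := by
  classical
  set T := (fun z : Edge 3 L → Fin 3 → ℝ => fun e => gnoPoint (z e)) '' W with hTdef
  have hconf : configMeasure SU2 L = Measure.pi fun _ : Edge 3 L => haarProbability SU2 := rfl
  rw [hconf, pi_haar_su2_eq_sum_piPatternChart (Edge 3 L), Measure.sum_apply _ hT, tsum_fintype]
  rw [Finset.sum_eq_single (fun _ : Edge 3 L => false)]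
  · rw [Measure.map_apply (measurable_piPatternChart (Edge 3 L) _) hT]
    congr 1
    ext z
    simp only [Set.mem_preimage, hTdef, Set.mem_image]
    constructor
    · rintro ⟨z', hz', h⟩
      have hzz : z' = z := by
        funext e
        have := congrArg (fun U => U e) h
        simp only [piPatternChart_false] at this
        exact gnoPoint_injective this
      rwa [hzz] at hz'
    · intro hz
      exact ⟨z, hz, funext fun e => (piPatternChart_false (Edge 3 L) z e).symm⟩
  · intro z _ hz
    obtain ⟨i, hi⟩ := exists_true_of_ne_false (Edge 3 L) hz
    rw [Measure.map_apply (measurable_piPatternChart (Edge 3 L) _) hT]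
    have hemp : piPatternChart (Edge 3 L) z ⁻¹' T = ∅ := by
      ext w
      simp only [Set.mem_preimage, Set.mem_empty_iff_false, iff_false, hTdef, Set.mem_image, not_exists, not_and]
      intro z' _ h
      have h1 := scalarPart_piPatternChart_neg (Edge 3 L) hi w
      have h2 : 0 < scalarPart (piPatternChart (Edge 3 L) z w i) := by rw [← h]; exact scalarPart_gnoPoint_pos _
      linarith
    rw [hemp, measure_empty]
  · intro h; exact (h (Finset.mem_univ _)).elim

/-- The product gnomonic density is at most `(2π²)^{-|E|} ≤ 1`-type constant everywhere and at least a positive constant on the sup-box `{|z_e a| ≤ 2}`. [folklore] -/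
theorem piGnDensity_bounds (z : Edge 3 L → Fin 3 → ℝ) :
    piGnDensity (Edge 3 L) z ≤ ENNReal.ofReal (((2 * π ^ 2)⁻¹) ^ Fintype.card (Edge 3 L)) ∧
      ((∀ (e : Edge 3 L) (a : Fin 3), |z e a| ≤ 2) → ENNReal.ofReal (((2 * π ^ 2)⁻¹ * ((1 + 3 * 2 ^ 2)⁻¹) ^ 2) ^ Fintype.card (Edge 3 L)) ≤ piGnDensity (Edge 3 L) z) := by
  refine ⟨?_, fun hz => ?_⟩
  · rw [piGnDensity_eq]; exact ENNReal.ofReal_le_ofReal (piGnDensityReal_pos_le (Edge 3 L) z).2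
  · rw [piGnDensity_eq, piGnDensityReal, ← Finset.card_univ, ← Finset.prod_const]
    refine ENNReal.ofReal_le_ofReal (Finset.prod_le_prod (fun e _ => by positivity) fun e _ => ?_)
    exact gnoWeight_ge_of_mem_cube (S := 2) ((mem_cube_iff).2 fun a => hz e a)

/-- ★ **Two-sided comparison of the gnomonic chart law with Lebesgue measure** on sets inside the sup-box `{|z_e a| ≤ 2}` (any set `W`, measurable or not).
[folklore] -/
theorem withDensity_piGnDensity_two_sided {W : Set (Edge 3 L → Fin 3 → ℝ)} (hW : W ⊆ {z | ∀ (e : Edge 3 L) (a : Fin 3), |z e a| ≤ 2}) :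
    ENNReal.ofReal (((2 * π ^ 2)⁻¹ * ((1 + 3 * 2 ^ 2)⁻¹) ^ 2) ^ Fintype.card (Edge 3 L)) * volume W ≤
        ((volume : Measure (Edge 3 L → Fin 3 → ℝ)).withDensity (piGnDensity (Edge 3 L))) W ∧
      ((volume : Measure (Edge 3 L → Fin 3 → ℝ)).withDensity (piGnDensity (Edge 3 L))) W ≤ ENNReal.ofReal (((2 * π ^ 2)⁻¹) ^ Fintype.card (Edge 3 L)) * volume W := by
  have hK : MeasurableSet {z : Edge 3 L → Fin 3 → ℝ | ∀ (e : Edge 3 L) (a : Fin 3), |z e a| ≤ 2} := by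
    have h : {z : Edge 3 L → Fin 3 → ℝ | ∀ (e : Edge 3 L) (a : Fin 3), |z e a| ≤ 2} = ⋂ e : Edge 3 L, ⋂ a : Fin 3, {z | |z e a| ≤ 2} := by ext z; simp
    rw [h]
    exact MeasurableSet.iInter fun e => MeasurableSet.iInter fun a =>
      measurableSet_le (continuous_abs.measurable.comp ((measurable_pi_apply a).comp (measurable_pi_apply e))) measurable_const
  rw [withDensity_apply' _ W]
  constructor
  · set c : ℝ≥0∞ := ENNReal.ofReal (((2 * π ^ 2)⁻¹ * ((1 + 3 * 2 ^ 2)⁻¹) ^ 2) ^ Fintype.card (Edge 3 L))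
    have hle : ∀ z, ({z : Edge 3 L → Fin 3 → ℝ | ∀ (e : Edge 3 L) (a : Fin 3), |z e a| ≤ 2}.indicator (fun _ => c) z) ≤ piGnDensity (Edge 3 L) z := fun z => by
      by_cases hz : z ∈ {z : Edge 3 L → Fin 3 → ℝ | ∀ (e : Edge 3 L) (a : Fin 3), |z e a| ≤ 2}
      · rw [Set.indicator_of_mem hz]; exact (piGnDensity_bounds L z).2 hz
      · rw [Set.indicator_of_notMem hz]; exact bot_le
    calc c * volume W = c * (volume.restrict W) {z : Edge 3 L → Fin 3 → ℝ | ∀ (e : Edge 3 L) (a : Fin 3), |z e a| ≤ 2} := by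
          rw [Measure.restrict_apply hK, Set.inter_eq_right.2 hW]
      _ = ∫⁻ z in W, {z : Edge 3 L → Fin 3 → ℝ | ∀ (e : Edge 3 L) (a : Fin 3), |z e a| ≤ 2}.indicator (fun _ => c) z := by
          rw [lintegral_indicator hK, setLIntegral_const]
      _ ≤ ∫⁻ z in W, piGnDensity (Edge 3 L) z := lintegral_mono hle
  · calc ∫⁻ z in W, piGnDensity (Edge 3 L) z ≤ ∫⁻ _z in W, ENNReal.ofReal (((2 * π ^ 2)⁻¹) ^ Fintype.card (Edge 3 L)) := lintegral_mono fun z => (piGnDensity_bounds L z).1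
      _ = ENNReal.ofReal (((2 * π ^ 2)⁻¹) ^ Fintype.card (Edge 3 L)) * volume W := setLIntegral_const _ _

end Summit.QuantumFields.YangMills.Theorems.FemtoTransferGap.TwoLattice.ConstTube

end
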